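import Mathlib
import HarnessLib
import Literature.MathematicalPhysics.QuantumFieldTheory.ConstructiveQFTWave0
import Literature.Probability.LatticeModels.LatticeGraph
import Literature.Combinatorics.SimpleGraph.EliminationGraph
import Summits.Ventures.LatticeQCDFlow.Exactness.OpenBoundaryWilsonAction
import Summits.Ventures.LatticeQCDFlow.Scaling.EliminationFrontRaster
import Summits.Ventures.LatticeQCDFlow.Scaling.AutoregressiveMarkovContext
import Summits.Ventures.LatticeQCDFlow.Scaling.AutoregressiveFrontierInstances

/-!
# LatticeQCDFlow / Scaling — a folded raster order on the LINKS of `(ℤ/L)^d`: the plaquette-sharing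
# graph has elimination width `≤ 4d·L^{d−1} + d`, so the symbolic autoregressive context of a gauge
# link is `O(L^{d−1})` in that order

HONEST FRAMING: exact (Metropolis-corrected) sampling algorithms for lattice gauge theory;
figures of merit are autocorrelation/cost numbers at stated couplings and volumes; no
continuum-physics claim.

Venture `LatticeQCDFlow` (cell pub-lqcd), topic `Scaling`, FANOUT row 30 (lean-1, GEN-16) — OUR WORK on
THEORY-2.md §3.1 / §4 T2-AF (a) ("frontier `≤ 3·L^{d−1}` sites, `≤ 3d·L^{d−1}` links for a plaquette
action" — brute force on small tori, `v18/frontier_check.py`).  GEN-14 typed the SITE half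
(`Scaling/EliminationFrontRaster`: the folded raster order of the sites has elimination width
`≤ 2·L^{d−1}` for the torus graph).  This file types the LINK half: lift the folded raster labelling
to links, `rank(x, μ) = d·foldedRank(x) + μ`, and bound the bandwidth of the PLAQUETTE-SHARING graph
(two distinct links are adjacent iff some plaquette contains both; written inline with
`SimpleGraph.fromRel` over the tree's `Exactness.plaquetteEdges`):

* `linkFoldedRank`, `linkFoldedRank_injective`, `linkFoldedRasterOrder` (`LinearOrder.lift'`);
* `foldedRank_plaquetteEdges_le` — the base sites of two links of one plaquette are equal, adjacent,
  or two steps apart, so their folded labels differ by `≤ 4·L^{d−1}` (GEN-14 `foldedRank_adj_le`);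
  `linkFoldedRank_plaquetteEdges_le` — hence the link labels differ by `≤ 4d·L^{d−1} + d`;
* **`plaquetteGraph_elimWidth_linkFoldedRaster_le`** — in the lifted order every link has at most
  `4d·L^{d−1} + d` higher fill-neighbours in the plaquette-sharing graph (`L ≥ 2`; GEN-14
  `elimWidth_le_of_bandwidth`); `ncard_higherAdj_plaquetteGraph_le` per link;
* **`wilson_context_linkFoldedRaster`** — with `Scaling/AutoregressiveFrontierInstances` (A): the exact
  conditional of a link given the higher links reads only the link and a set of `≤ 4d·L^{d−1} + d`
  links (compact second-countable `G`, continuous `ρ`, every real `β`).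

READING (value-free, T2-AF (a)): with `Scaling/AutoregressiveFrontierInstances` (A) (the exact
conditional of a link given the higher links reads only the link and its higher fill-neighbourhood in
the plaquette-sharing graph) this gives: AN EXACT AUTOREGRESSIVE SAMPLER OF THE WILSON THEORY IN LINK
VARIABLES NEEDS SYMBOLIC CONTEXT AT MOST `4d·L^{d−1} + d + 1 = O(V^{1−1/d})` PER LINK in the lifted
folded raster order — and the true context is smaller still (gauge reduction, GEN-15/16).  The
constant is not optimised (the cell's brute force sees `≤ 3d·L^{d−1}`); the order `L^{d−1}` is the
content.  NOT CLAIMED: optimality of the order; any lower bound for links; any number of ours beyond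
the stated bound.  `def linkFoldedRank`, `def linkFoldedRasterOrder`; nothing is cited as a fact; no
`sorry`.
-/

noncomputable section

namespace Summit.Ventures.LatticeQCDFlow.Theory2.Autoregressive

open Finset Function
open Literature.MathematicalPhysics.QuantumFieldTheory
open Literature.Probability.LatticeModels (TorusSite torusGraph torusGraph_adj_iff)
open Literature.Combinatorics.SimpleGraph Literature.LinearAlgebra.Matrix.ChordalSparsity
open Summit.Ventures.LatticeQCDFlow.Exactness (plaquetteEdges mem_plaquetteEdges)

variable {d L : ℕ}

/-! ## §1 The lifted labelling -/

/-- The folded raster labelling of LINKS: `rank(x, μ) = d·foldedRank(x) + μ`. [ours] -/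
def linkFoldedRank [NeZero L] (e : Edge d L) : ℕ := d * foldedRank e.1 + e.2

/-- The link labelling is injective. [ours] -/
theorem linkFoldedRank_injective [NeZero L] :
    Function.Injective (linkFoldedRank (d := d) (L := L)) := by
  rintro ⟨x, μ⟩ ⟨y, ν⟩ h
  simp only [linkFoldedRank] at h
  have hμ := μ.isLt
  have hν := ν.isLt
  have hd : 0 < d := Fin.pos μ
  have h1 : foldedRank x = foldedRank y := by
    have hx : (d * foldedRank x + μ) / d = foldedRank x := by
      rw [Nat.mul_add_div hd, Nat.div_eq_of_lt hμ, add_zero]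
    have hy : (d * foldedRank y + ν) / d = foldedRank y := by
      rw [Nat.mul_add_div hd, Nat.div_eq_of_lt hν, add_zero]
    rw [← hx, ← hy, h]
  have h2 : (μ : ℕ) = ν := by rw [h1] at h; omega
  exact Prod.ext (foldedRank_injective h1) (Fin.ext h2)

/-- The FOLDED RASTER ORDER on links: `e < e' ↔ rank e < rank e'`. [ours] -/
@[reducible] noncomputable def linkFoldedRasterOrder (d L : ℕ) [NeZero L] : LinearOrder (Edge d L) :=
  LinearOrder.lift' (linkFoldedRank (d := d) (L := L)) linkFoldedRank_injective

/-! ## §2 Bandwidth of the plaquette-sharing graph -/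

/-- Across a shift `x ↦ x + e_i` the folded site label moves by at most `2·L^{d−1}`, both ways
(`L ≥ 2`; GEN-14 `foldedRank_adj_le`). [ours] -/
theorem foldedRank_shift_le [NeZero L] (hL : 2 ≤ L) (x : Site d L) (i : Fin d) :
    foldedRank (x.shift i) ≤ foldedRank x + 2 * L ^ (d - 1) ∧
      foldedRank x ≤ foldedRank (x.shift i) + 2 * L ^ (d - 1) := by
  haveI : Fact (1 < L) := ⟨hL⟩
  have hadj : (torusGraph d L).Adj x (x.shift i) := by
    refine (torusGraph_adj_iff _ _).2 ⟨fun h => ?_, Or.inl ⟨i, rfl⟩⟩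
    have h' := congrFun h i
    simp [Site.shift] at h'
  exact ⟨foldedRank_adj_le hL hadj, foldedRank_adj_le hL hadj.symm⟩

/-- The base sites of two links of one plaquette have folded labels at distance `≤ 4·L^{d−1}`. [ours] -/
theorem foldedRank_plaquetteEdges_le [NeZero L] (hL : 2 ≤ L) (p : Plaquette d L) {e e' : Edge d L}
    (he : e ∈ plaquetteEdges p) (he' : e' ∈ plaquetteEdges p) :
    foldedRank e'.1 ≤ foldedRank e.1 + 4 * L ^ (d - 1) := by
  obtain ⟨hi1, hi2⟩ := foldedRank_shift_le hL p.1 p.2.1.1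
  obtain ⟨hj1, hj2⟩ := foldedRank_shift_le hL p.1 p.2.1.2
  rw [mem_plaquetteEdges] at he he'
  rcases he with rfl | rfl | rfl | rfl <;> rcases he' with rfl | rfl | rfl | rfl <;>
    simp only <;> omega

/-- Hence the LINK labels of two links of one plaquette differ by at most `4d·L^{d−1} + d`. [ours] -/
theorem linkFoldedRank_plaquetteEdges_le [NeZero L] (hL : 2 ≤ L) (p : Plaquette d L)
    {e e' : Edge d L} (he : e ∈ plaquetteEdges p) (he' : e' ∈ plaquetteEdges p) :
    linkFoldedRank e' ≤ linkFoldedRank e + (4 * d * L ^ (d - 1) + d) := by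
  have h := foldedRank_plaquetteEdges_le hL p he he'
  have hμ := e.2.isLt
  have hν := e'.2.isLt
  simp only [linkFoldedRank]
  have : d * foldedRank e'.1 ≤ d * foldedRank e.1 + 4 * d * L ^ (d - 1) := by
    calc d * foldedRank e'.1 ≤ d * (foldedRank e.1 + 4 * L ^ (d - 1)) := Nat.mul_le_mul_left d h
      _ = d * foldedRank e.1 + 4 * d * L ^ (d - 1) := by ring
  omega

/-! ## §3 The elimination width of the plaquette-sharing graph in the lifted order -/

/-- **THE PLAQUETTE-SHARING GRAPH HAS ELIMINATION WIDTH `≤ 4d·L^{d−1} + d` IN THE LIFTED FOLDED RASTER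
ORDER** (`L ≥ 2`): every link has at most that many higher fill-neighbours. [ours] -/
theorem plaquetteGraph_elimWidth_linkFoldedRaster_le [NeZero L] (hL : 2 ≤ L) :
    @elimWidth (Edge d L) (linkFoldedRasterOrder d L) _
        (SimpleGraph.fromRel fun e e' : Edge d L =>
          ∃ p : Plaquette d L, e ∈ plaquetteEdges p ∧ e' ∈ plaquetteEdges p) ≤
      4 * d * L ^ (d - 1) + d := by
  letI : LinearOrder (Edge d L) := linkFoldedRasterOrder d L
  refine elimWidth_le_of_bandwidth linkFoldedRank (fun e e' h => h) (4 * d * L ^ (d - 1) + d)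
    fun u w huw => ?_
  obtain ⟨-, ⟨p, hu, hw⟩ | ⟨p, hw, hu⟩⟩ := (SimpleGraph.fromRel_adj _ _ _).1 huw
  · exact linkFoldedRank_plaquetteEdges_le hL p hu hw
  · exact linkFoldedRank_plaquetteEdges_le hL p hu hw

/-- Per link: in the lifted folded raster order the higher fill-neighbourhood of every link in the
plaquette-sharing graph has at most `4d·L^{d−1} + d` elements — the SYMBOLIC autoregressive context
of a gauge link is `O(L^{d−1}) = O(V^{1−1/d})` (T2-AF (a), link half). [ours] -/
theorem ncard_higherAdj_plaquetteGraph_le [NeZero L] (hL : 2 ≤ L) (a : Edge d L) :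
    letI := linkFoldedRasterOrder d L
    (higherAdj (elimGraph (SimpleGraph.fromRel fun e e' : Edge d L =>
        ∃ p : Plaquette d L, e ∈ plaquetteEdges p ∧ e' ∈ plaquetteEdges p)).Adj a).ncard ≤
      4 * d * L ^ (d - 1) + d := by
  letI : LinearOrder (Edge d L) := linkFoldedRasterOrder d L
  exact (ncard_higherAdj_elimGraph_le_elimWidth a).trans
    (plaquetteGraph_elimWidth_linkFoldedRaster_le hL)

/-! ## §4 With the frontier bound: the symbolic context of a gauge link is `O(L^{d−1})` -/

section Wilson

open MeasureTheory Summit.Ventures.LatticeQCDFlow.Exactness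

variable {N : ℕ} {G : Type*} [Group G] [TopologicalSpace G] [IsTopologicalGroup G] [CompactSpace G]
  [MeasurableSpace G] [BorelSpace G] [SecondCountableTopology G]

/-- **AN EXACT AUTOREGRESSIVE SAMPLER OF THE WILSON THEORY IN LINK VARIABLES NEEDS SYMBOLIC CONTEXT AT
MOST `4d·L^{d−1} + d` LINKS PER STEP** (lifted folded raster order; compact second-countable `G`,
continuous `ρ`, every real `β`, `L ≥ 2`): the higher fill-neighbourhood of the link `a` in the
plaquette-sharing graph has at most `4d·L^{d−1} + d` elements, and the exact conditional of `U_a`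
given the higher links (`w = e^{−β S_W}`, product Haar reference) takes the same value on
configurations agreeing at `a` and on that set (`Scaling/AutoregressiveFrontierInstances` (A)).
[ours] -/
theorem wilson_context_linkFoldedRaster [NeZero L] (hL : 2 ≤ L)
    (ρ : G →* Matrix (Fin N) (Fin N) ℂ) (hρ : Continuous ρ) (β : ℝ) (a : Edge d L) :
    letI := linkFoldedRasterOrder d L
    (higherAdj (elimGraph (SimpleGraph.fromRel fun e e' : Edge d L =>
        ∃ p : Plaquette d L, e ∈ plaquetteEdges p ∧ e' ∈ plaquetteEdges p)).Adj a).ncard ≤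
      4 * d * L ^ (d - 1) + d ∧
    ∀ {U U' : GaugeConfig d L G}, U a = U' a →
      (∀ e ∈ higherAdj (elimGraph (SimpleGraph.fromRel fun e e' : Edge d L =>
        ∃ p : Plaquette d L, e ∈ plaquetteEdges p ∧ e' ∈ plaquetteEdges p)).Adj a, U e = U' e) →
      coordAvg (haarProbability G) (Finset.univ.filter (· < a))
            (fun V => Real.exp (-β * wilsonAction ρ V)) U /
          coordAvg (haarProbability G) (insert a (Finset.univ.filter (· < a)))
            (fun V => Real.exp (-β * wilsonAction ρ V)) U =
        coordAvg (haarProbability G) (Finset.univ.filter (· < a))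
            (fun V => Real.exp (-β * wilsonAction ρ V)) U' /
          coordAvg (haarProbability G) (insert a (Finset.univ.filter (· < a)))
            (fun V => Real.exp (-β * wilsonAction ρ V)) U' := by
  letI : LinearOrder (Edge d L) := linkFoldedRasterOrder d L
  exact ⟨ncard_higherAdj_plaquetteGraph_le hL a,
    fun ha h => wilson_arConditional_congr_of_higherAdj ρ hρ β a ha h⟩

end Wilson

end Summit.Ventures.LatticeQCDFlow.Theory2.Autoregressive

end
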